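import Summits.HodgeConjecture.HodgeConjecture.Theorems.BiquadraticSecantLiftDiscriminantSplit
import Summits.HodgeConjecture.HodgeConjecture.Theorems.BiquadraticSecantLiftDiscriminantSign
import Summits.HodgeConjecture.HodgeConjecture.Theorems.BiquadraticSecantLiftKaehler
import Summits.HodgeConjecture.HodgeConjecture.Theorems.BiquadraticSecantLiftHyperbolicTransport
import Literature.AlgebraicGeometry.Deligne1982.HyperbolicOfSplitDiscriminantCMKaehler
import Literature.AlgebraicGeometry.Deligne1982.ProductPolarizationKaehlerCM
import Literature.AlgebraicGeometry.HodgeTheory.PowSuccProductCone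
import Literature.AlgebraicGeometry.HodgeTheory.DivisorLefschetzGroupCentreFiniteIntrinsic
import Literature.AlgebraicGeometry.Motives.RationalDegreeOneModel
import Literature.AlgebraicGeometry.HodgeTheory.WeilClassesCMReductionPolarized
import Literature.AlgebraicGeometry.HodgeTheory.IsoTransport
import HarnessLib

/-!
# BiquadraticSecantLift · X2pol `BiquadraticBaseChangePolarized` — the polarisation `E_A ⊕ m·E_A` on `A ⊞ A` IS a
# polarization: the base-changed datum is a POLARIZED hyperbolic Weil-type CM datum (proved)

Helper file (`--supports stmt-HodgeConjecture-22132`, the only open crux X1 `MarkmanBiquadraticTwelvefolds` of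
route-HodgeConjecture-BiquadraticSecantLift). Nothing here proves the Hodge conjecture, rung H2 `WeilSixfolds` or X1.

## Why (the REACH stub of X1's registered line)
The REACH stub `stub_seedReach : SeedReach` of the registered skeleton `Cruxes/MarkmanBiquadraticTwelvefolds/Lines/prymseed.lean`
(§0–§4 = `Lines/seed.lean` verbatim) is closed by `Theorems/MarkmanBiquadraticTwelvefoldsSeedReach.lean` (p606540) from the
named fact `HodgeTheory.deligne1982_weilFamilyReachCM_polarizedSplit` for GENUINELY POLARIZED targets
(`HodgeTheory.IsPolarizedHyperbolicWeilTypeCM`: Deligne Thm. 4.8 (a)+(b) for a polarization CLASS a real multiple of which is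
KÄHLER), whereas X1 — hence `SeedReachAt` — quantifies over CLASS-LEVEL targets (`HodgeTheory.IsHyperbolicWeilTypeCM`: no
positivity). The targets that the route's deciding theorem `closes` actually feeds to X1 are the base changes
`(A ⊞ A, η_(d,m))` produced by X2 `BiquadraticBaseChangeHyperbolic` (closed, p597146). THIS FILE proves that those targets ARE
polarized: the class-level conclusion of X2 is upgraded to `IsPolarizedHyperbolicWeilTypeCM` (theorem
`biquadraticBaseChangePolarized`, the statement `BiquadraticBaseChangePolarized` of the planner's retarget memo
`Cruxes/MarkmanBiquadraticTwelvefolds/RETARGET-X1pol.md`, with the route's polynomial spelled out), so that REACH (p606540,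
`seedReachAt_polarized_of_weilFamilyReachCM`) applies to every target of the assembly with NO positivity hypothesis, and the
proposed polarized re-cut `closes_pol : X1pol → X2pol → X3 → WeilSixfolds` has its X2pol binder already proved (X2 itself
follows back by `IsPolarizedHyperbolicWeilTypeCM.isHyperbolicWeilTypeCM`; it is closed since p597146 and is not restated here).

## Proof
X2's own proof (`Theorems/BiquadraticSecantLiftBiquadraticBaseChangeHyperbolic.lean`) builds on `B = ⨁_{Fin 2} A` the class
`h₂ = π₀^*k + m·π₁^*k` together with a KÄHLER real multiple (`hK2`, from `exists_isKaehlerClass_smul_prodClass`) and proves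
Rosati = complex conjugation, split Deligne discriminant and the `η^*`-stable rational Lagrangian for THAT class; so
`IsPolarizedHyperbolicWeilTypeCM.intro'` applies verbatim (§3, `isPolarizedHyperbolicWeilTypeCM_twelvefold`). The passage to
the route's `A ⊞ A` along `biprodIsoTwelvefold` needs, beyond X2's transport of the four class-level clauses
(`isHyperbolicWeilTypeCM_of_iso`), the transport of KÄHLER classes along an isomorphism of `ℂ`-schemes (§1,
`isKaehlerClass_map_of_iso`: same complex manifold, Kähler metric and de Rham comparison, analytification composed with
`e(ℂ)` — `IsAnalytification.transport_iso`, exactly as the tree's `IsOfHodgeType.of_map_iso`), whence the pointed transport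
of all five clauses (§2, `isPolarizedHyperbolicWeilTypeCM_of_iso`).

## References
[cite: Deligne1982HodgeCycles, §4 Thm. 4.8 (a)–(b), Cor. 4.2, Lemma 4.6, §5 (c) p. 39] [cite: vanGeemen1994HodgeAV, §5 (5.2–5.4)]
[cite: Landherr1936HermitianForms] [cite: Milne2020HodgeClassesAV, §2 2.1] [cite: SerreGAGA1956, §2] [cite: VoisinHodgeI2002, §3.1.3, §7.1.2]
-/

-- every declaration of this problem lives in `Summit.HodgeConjecture.HodgeConjecture.…` (summit = sub-problem)
set_option linter.dupNamespace false

noncomputable section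

open CategoryTheory CategoryTheory.Limits Polynomial Module
open Literature.AlgebraicTopology.SingularHomology Literature.Geometry.Kaehler
open Literature.AlgebraicGeometry.HodgeTheory
open Literature.AlgebraicGeometry.Motives (AbelianVariety IsSmoothProjective polarizationPairingOne map_polarizationPairingOne
  ProjectiveEmbedding)
open Literature.AlgebraicGeometry.Motives.AbelianVariety (IsIsogeny dim_eq_of_isIsogeny)
open Literature.AlgebraicGeometry.Milne1999 (sumPolarizationClass)
open Literature.AlgebraicGeometry.VanGeemen1994 (pullbackOne)
open Literature.AlgebraicGeometry.Deligne1982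
open Summit.HodgeConjecture.HodgeConjecture.Ring2.AbelianAll (hasWeilDiscriminantCM_of_transport isHyperbolicWeilType_comap_of_comm)

namespace Summit.HodgeConjecture.HodgeConjecture.BiquadraticSecantLift

/-! ## §1 Kähler classes transport along isomorphisms of `ℂ`-schemes -/

section KaehlerIso

variable {n : ℕ} {X X' : Literature.AlgebraicGeometry.Motives.SchemeOver ℂ}

/-- **Kähler classes descend along an isomorphism**: for `e : X ≅ X'`, if `e^* H'` is a Kähler class of `X` (Hodge model
`A`: complex manifold `M`, analytification `φ : M → X(ℂ)`, Kähler metric `g`, de Rham family `e_dR`, `A^*(e^*H') = [ω_g]`),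
then `H'` is a Kähler class of `X'`, witnessed by the SAME manifold, metric and family and the analytification
`e(ℂ) ∘ φ` (`IsAnalytification.transport_iso`), whose pull-back of `H'` IS `A^*(e^* H')`. [cite: SerreGAGA1956, §2]
[cite: VoisinHodgeI2002, §3.1.3 and §7.1.2] -/
theorem isKaehlerClass_of_map_iso (e : X ≅ X') {H' : complexBetti X' 2}
    (h : IsKaehlerClass n X (complexBetti.map e.hom 2 H')) : IsKaehlerClass n X' H' := by
  obtain ⟨A, hω, g, hg, eR, heR, hem, hH⟩ := h
  let A' : HodgeModel n X' :=
    { A with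
      toComplexPoints := Literature.AlgebraicGeometry.Motives.AlgPoints.map e.hom ∘ A.toComplexPoints
      isAnalytification := A.isAnalytification.transport_iso e }
  refine ⟨A', hω, g, hg, eR, heR, hem, ?_⟩
  have hc : (⟨A'.toComplexPoints, A'.isAnalytification.isHomeomorph.continuous⟩ :
        C(A.carrier, Literature.AlgebraicGeometry.Motives.ComplexPoints X')) =
      (Literature.AlgebraicGeometry.Motives.AlgPoints.mapContinuous (L := ℂ) e.hom).comp
        ⟨A.toComplexPoints, A.isAnalytification.isHomeomorph.continuous⟩ :=
    ContinuousMap.ext fun _ ↦ rfl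
  change singularCohomology.map ℂ ℂ
      (⟨A'.toComplexPoints, A'.isAnalytification.isHomeomorph.continuous⟩ :
        C(A.carrier, Literature.AlgebraicGeometry.Motives.ComplexPoints X')) 2 H' = _
  rw [hc, singularCohomology.map_comp]
  exact hH

/-- **Kähler classes pull back along an isomorphism**: for `e : X' ≅ X` and a Kähler class `H` of `X`, `e^* H` is a Kähler
class of `X'` (`isKaehlerClass_of_map_iso` for `e⁻¹`, as `(e⁻¹)^* e^* H = H`). [cite: SerreGAGA1956, §2] [cite: VoisinHodgeI2002, §7.1.2] -/
theorem isKaehlerClass_map_of_iso (e : X' ≅ X) {H : complexBetti X 2} (h : IsKaehlerClass n X H) :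
    IsKaehlerClass n X' (complexBetti.map e.hom 2 H) := by
  refine isKaehlerClass_of_map_iso e.symm ?_
  rwa [Iso.symm_hom, e.complexBetti_map_inv_map_hom]

/-- The Kähler-multiple clause of `IsPolarizedHyperbolicWeilTypeCM` pulls back along an isomorphism `e : X' ≅ X` of schemes of
the same dimension. [cite: VoisinHodgeI2002, §7.1.2] -/
theorem exists_isKaehlerClass_smul_map_of_iso (e : X' ≅ X) {H : complexBetti X 2}
    (h : ∃ s : ℝ, s ≠ 0 ∧ IsKaehlerClass n X ((s : ℂ) • H)) :
    ∃ s : ℝ, s ≠ 0 ∧ IsKaehlerClass n X' ((s : ℂ) • complexBetti.map e.hom 2 H) := by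
  obtain ⟨s, hs, hK⟩ := h
  refine ⟨s, hs, ?_⟩
  rw [← map_smul]
  exact isKaehlerClass_map_of_iso e hK

end KaehlerIso

/-! ## §2 `IsPolarizedHyperbolicWeilTypeCM` is invariant under equivariant isomorphisms -/

/-- **`IsPolarizedHyperbolicWeilTypeCM` transfers along an equivariant isomorphism `e : B' ≅ B`** (`η' ≫ e.hom = e.hom ≫ η`),
with the class `e^* h`: Weil type along the isogeny `e.hom`, the polarization class, ITS KÄHLER MULTIPLE (§1), the Rosati
condition and the discriminant witness (`e^*` bijective on `H¹` and on the top pairing degree), and the Lagrangian — the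
pointed form of X2's `isHyperbolicWeilTypeCM_of_iso` with the positivity clause added.
[cite: Deligne1982HodgeCycles, §4 Thm. 4.8 (a)–(b), Cor. 4.2, Lemma 4.6] [cite: vanGeemen1994HodgeAV, Lemma 5.2 (3)] -/
theorem isPolarizedHyperbolicWeilTypeCM_of_iso {B B' : AbelianVariety ℂ} {η : B ⟶ B} {η' : B' ⟶ B'} (e : B' ≅ B)
    (hcomm : η' ≫ e.hom = e.hom ≫ η) {R : Polynomial ℤ} {e₀ k : ℕ} (hB : IsPolarizedHyperbolicWeilTypeCM B η R e₀ k) :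
    IsPolarizedHyperbolicWeilTypeCM B' η' R e₀ k := by
  obtain ⟨hW, h, hpol, hK, hros, hdisc, hhyp⟩ := hB
  haveI := hW.fact_irreducible_map_real
  have hiso : IsIsogeny e.hom := isIsogeny_hom_of_iso e
  have hW' : IsWeilTypeCM B' η' R e₀ k := hW.of_isIsogeny' hiso hcomm.symm
  have hdim : B'.dim = B.dim := dim_eq_of_isIsogeny hiso
  have hXB : IsSmoothProjective B.dim B.X := Literature.AlgebraicGeometry.Motives.AbelianVariety.isSmoothProjective_holds
  have hXB' : IsSmoothProjective B'.dim B'.X := Literature.AlgebraicGeometry.Motives.AbelianVariety.isSmoothProjective_holds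
  -- the isomorphism of underlying schemes
  let eX : B'.X ≅ B.X :=
    { hom := e.hom.hom.hom.hom
      inv := e.inv.hom.hom.hom
      hom_inv_id := by
        change (e.hom ≫ e.inv).hom.hom.hom = (𝟙 B' : B' ⟶ B').hom.hom.hom
        rw [e.hom_inv_id]
      inv_hom_id := by
        change (e.inv ≫ e.hom).hom.hom.hom = (𝟙 B : B ⟶ B).hom.hom.hom
        rw [e.inv_hom_id] }
  have hehom : eX.hom = e.hom.hom.hom.hom := rfl
  -- `e^*` is bijective on every cohomology group
  have hbij : ∀ i, Function.Bijective (complexBetti.map e.hom.hom.hom.hom i) := fun i ↦ by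
    rw [← hehom]; exact complexBetti.bijective_map_of_iso eX i
  -- intertwining and compatibility with the pairings
  have hTφ : ∀ x : complexBetti B.X 1, complexBetti.map e.hom.hom.hom.hom 1 (complexBetti.map η.hom.hom.hom 1 x) =
      complexBetti.map η'.hom.hom.hom 1 (complexBetti.map e.hom.hom.hom.hom 1 x) := fun x ↦ by
    rw [complexBetti_map_map_hom, complexBetti_map_map_hom, hcomm]
  have hTQ : ∀ x y : complexBetti B.X 1, complexBetti.map e.hom.hom.hom.hom (2 + 2 * (B.dim - 1))
      (polarizationPairingOne B.X h (B.dim - 1) x y) =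
      polarizationPairingOne B'.X (complexBetti.map e.hom.hom.hom.hom 2 h) (B.dim - 1)
        (complexBetti.map e.hom.hom.hom.hom 1 x) (complexBetti.map e.hom.hom.hom.hom 1 y) :=
    fun x y ↦ map_polarizationPairingOne _ h _ x y
  refine ⟨hW', complexBetti.map e.hom.hom.hom.hom 2 h, ?_, ?_, ?_, ?_, ?_⟩
  · -- polarization class (stated at `dim B'`, proved at `dim B`)
    have key : ∀ n, n = B.dim → IsPolarizationClass n B'.X (complexBetti.map e.hom.hom.hom.hom 2 h) := by
      rintro n rfl
      rw [← hehom]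
      exact hpol.map_of_iso hXB hXB' eX
    exact key _ hdim
  · -- the Kähler multiple rides along `e^*` (§1)
    have key : ∀ n, n = B.dim → ∃ s : ℝ, s ≠ 0 ∧ IsKaehlerClass n B'.X ((s : ℂ) • complexBetti.map e.hom.hom.hom.hom 2 h) := by
      rintro n rfl
      rw [← hehom]
      exact exists_isKaehlerClass_smul_map_of_iso eX hK
    exact key _ hdim
  · -- Rosati: `Q_{e^*h}(η'^* x', y') = -Q_{e^*h}(x', η'^* y')`
    have key : ∀ n, n = B.dim → ∀ x' y' : complexBetti B'.X 1,
        polarizationPairingOne B'.X (complexBetti.map e.hom.hom.hom.hom 2 h) (n - 1) (pullbackOne B' η' x') y' =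
          -polarizationPairingOne B'.X (complexBetti.map e.hom.hom.hom.hom 2 h) (n - 1) x' (pullbackOne B' η' y') := by
      rintro n rfl x' y'
      obtain ⟨x, rfl⟩ := (hbij 1).2 x'
      obtain ⟨y, rfl⟩ := (hbij 1).2 y'
      change polarizationPairingOne B'.X _ (B.dim - 1)
          (complexBetti.map η'.hom.hom.hom 1 (complexBetti.map e.hom.hom.hom.hom 1 x)) _ =
        -polarizationPairingOne B'.X _ (B.dim - 1) _
          (complexBetti.map η'.hom.hom.hom 1 (complexBetti.map e.hom.hom.hom.hom 1 y))
      rw [← hTφ, ← hTφ, ← hTQ, ← hTQ, ← map_neg]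
      exact congrArg _ (hros x y)
    exact key _ hdim
  · -- the discriminant witness rides along `e^*`
    exact hasWeilDiscriminantCM_of_transport (η := η) (ψ := η') rfl hdim
      (complexBetti.map e.hom.hom.hom.hom 1).hom (complexBetti.map e.hom.hom.hom.hom (2 + 2 * (B.dim - 1))).hom
      (hbij 1).1 (hbij _).1 (fun x hx ↦ isRationalClass_complexBetti_map _ hx)
      (fun ω hω ↦ isRationalClass_complexBetti_map _ hω) hTφ hTQ hdisc
  · -- the Lagrangian
    exact isHyperbolicWeilType_comap_of_comm e.hom hcomm.symm (hbij 1).1 hhyp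

/-! ## §3 `⨁_{Fin 2} A` with the class `π₀^* k + m·π₁^* k` is a POLARIZED hyperbolic Weil-type CM datum -/

section Twelvefold

variable {A : AbelianVariety ℂ} {φ : A ⟶ A} {d m : ℕ}

/-- **`⨁_{Fin 2} A` is of POLARIZED hyperbolic Weil type relative to `L`** — X2's `isHyperbolicWeilTypeCM_twelvefold` with the
conclusion upgraded to `IsPolarizedHyperbolicWeilTypeCM`: the witness class `h₂ = π₀^*k + m·π₁^*k` of that proof comes WITH a
Kähler real multiple (`hK2`), so Deligne's Thm. 4.8 (a)+(b) hold for a genuine polarization (`IsPolarizedHyperbolicWeilTypeCM.intro'`).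
Hypotheses verbatim those of `isHyperbolicWeilTypeCM_twelvefold`. [cite: Deligne1982HodgeCycles, §4 Thm. 4.8 (a)–(b), Cor. 4.2, §5 (c)]
[cite: Landherr1936HermitianForms] -/
theorem isPolarizedHyperbolicWeilTypeCM_twelvefold (hd : 0 < d) (hm : ¬ IsSquare m) (hφ : φ ≫ φ = -(d • 𝟙 A))
    (hWA : IsWeilTypeCM A φ (X + C (d : ℤ)) 1 3) (hirrK : Irreducible (cmPolyQ (X + C (d : ℤ))))
    {k : complexBetti A.X 2} (hQk : IsRationalClass k) (hk : complexBetti.map φ.hom.hom.hom 2 k = (d : ℂ) • k)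
    (hKk : ∃ s : ℝ, s ≠ 0 ∧ IsKaehlerClass A.dim A.X ((s : ℂ) • k))
    (hK2 : ∃ s : ℝ, s ≠ 0 ∧ IsKaehlerClass (twelvefold A).dim (twelvefold A).X
      ((s : ℂ) • sumPolarizationClass (fun _ : Fin 2 => A) ![k, (m : ℂ) • k]))
    {x : Fin (2 * 3) → complexBetti A.X 1} {ωA : complexBetti A.X (2 + 2 * (A.dim - 1))}
    {c : Fin (2 * 3) → Fin (2 * 3) → Fin (2 * 1) → ℚ} {Φ : Matrix (Fin (2 * 3)) (Fin (2 * 3)) (cmField (X + C (d : ℤ)))}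
    {q₀ tA : ℚ} (htA : tA ≠ 0) (hq0 : q₀ ≠ 0) (hx : ∀ b, IsRationalClass (x b))
    (hli : LinearIndependent ℂ (fun p : Fin (2 * 1) × Fin (2 * 3) => (pullbackOne A φ ^ (p.1 : ℕ)) (x p.2)))
    (hωA : ωA = ((tA : ℚ) : ℂ) • lefschetzPow k (A.dim - 1) 2 k)
    (hQx : ∀ (a b : Fin (2 * 3)) (j : Fin (2 * 1)),
      polarizationPairingOne A.X k (A.dim - 1) ((pullbackOne A φ ^ (j : ℕ)) (x a)) (x b) = ((c a b j : ℚ) : ℂ) • ωA)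
    (htr : ∀ (a b : Fin (2 * 3)) (j : Fin (2 * 1)),
      Algebra.trace ℚ (cmField (X + C (d : ℤ))) (cmRoot (X + C (d : ℤ)) ^ (j : ℕ) * Φ a b) = c a b j)
    (hq : AdjoinRoot.of (cmPolyQ (X + C (d : ℤ))) q₀ = cmRoot (X + C (d : ℤ)) ^ 6 * Φ.det)
    {v : realField (bqPoly d m)}
    (hv : (d : realField (bqPoly d m)) * v ^ 2 = AdjoinRoot.of (realPolyQ (bqPoly d m)) (-q₀)) :
    IsPolarizedHyperbolicWeilTypeCM (twelvefold A) (etaTwo A φ m) (bqPoly d m) 2 3 := by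
  have hm0 : m ≠ 0 := ne_zero_of_not_isSquare hm
  have hmC : (m : ℂ) ≠ 0 := Nat.cast_ne_zero.2 hm0
  have hWB : IsWeilTypeCM (twelvefold A) (etaTwo A φ m) (bqPoly d m) 2 3 := isWeilTypeCM_twelvefold hWA hm
  have hirrL : Irreducible (cmPolyQ (bqPoly d m)) := hWB.irreducible
  haveI hFL : Fact (Irreducible (realPolyQ (bqPoly d m))) := hWB.fact_irreducible_map_real
  have h2 := hWA.two_le_dim
  have hApos : 0 < A.dim := by omega
  have hAeq : A.dim = A.dim - 1 + 1 := by omega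
  -- Rosati for `k` on `A`, polarization, `L(k) ≠ 0`
  have hrosk : ∀ x y : complexBetti A.X 1,
      polarizationPairingOne A.X k (A.dim - 1) (complexBetti.map φ.hom.hom.hom 1 x) y =
        -polarizationPairingOne A.X k (A.dim - 1) x (complexBetti.map φ.hom.hom.hom 1 y) :=
    fun x y ↦ polarizationPairingOne_map_left_of_map_eq_smul hAeq hd hφ hk x y
  have hpolk : IsPolarizationClass A.dim A.X k := isPolarizationClass_of_isKaehlerClass_smul hQk hKk
  have hLk : lefschetzPow k (A.dim - 1) 2 k ≠ 0 :=
    Literature.AlgebraicGeometry.Motives.AbelianVariety.lefschetzPow_self_ne_zero_of_hasHardLefschetzProperty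
      (by omega) hpolk.hasHardLefschetz
  -- the class `h₂` on `B`
  have hQ2 : IsRationalClass (sumPolarizationClass (fun _ : Fin 2 => A) ![k, (m : ℂ) • k]) :=
    isRationalClass_sumPolarizationClass_two hQk
  have hpol2 : IsPolarizationClass (twelvefold A).dim (twelvefold A).X
      (sumPolarizationClass (fun _ : Fin 2 => A) ![k, (m : ℂ) • k]) :=
    isPolarizationClass_of_isKaehlerClass_smul hQ2 hK2
  have hB1 : 1 ≤ (twelvefold A).dim := by rw [dim_twelvefold]; omega
  have hLB := Literature.AlgebraicGeometry.Motives.AbelianVariety.lefschetzPow_self_ne_zero_of_hasHardLefschetzProperty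
    hB1 hpol2.hasHardLefschetz
  have hros2 : ∀ u w : complexBetti (twelvefold A).X 1,
      polarizationPairingOne (twelvefold A).X (sumPolarizationClass (fun _ : Fin 2 => A) ![k, (m : ℂ) • k])
          ((twelvefold A).dim - 1) (pullbackOne (twelvefold A) (etaTwo A φ m) u) w =
        -polarizationPairingOne (twelvefold A).X (sumPolarizationClass (fun _ : Fin 2 => A) ![k, (m : ℂ) • k])
          ((twelvefold A).dim - 1) u (pullbackOne (twelvefold A) (etaTwo A φ m) w) :=
    fun u w ↦ rosati_etaTwo hApos hmC hLk hrosk u w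
  -- the discriminant of `(B, η, h₂)` is split
  have hdisc := hasWeilDiscriminantCM_twelvefold_split hd hm hφ hirrL hirrK hApos hQk hLB htA hq0 hx hli hωA hQx htr hq hv
  -- Landherr
  haveI : Fact (Irreducible (cmPolyQ (bqPoly d m))) := ⟨hirrL⟩
  have hhyp : Literature.AlgebraicGeometry.Motives.IsHyperbolicWeilType (twelvefold A) (etaTwo A φ m) (3 * 2)
      (sumPolarizationClass (fun _ : Fin 2 => A) ![k, (m : ℂ) • k]) :=
    isHyperbolicWeilType_of_hasWeilDiscriminantCM_split_of_isKaehlerClass_smul hWB hQ2 hros2 hK2 hdisc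
  exact IsPolarizedHyperbolicWeilTypeCM.intro' hWB _ hpol2 hK2 hros2 hdisc hhyp

end Twelvefold

/-! ## §4 X2pol `BiquadraticBaseChangePolarized` — PROVED -/

/-- **X2pol `BiquadraticBaseChangePolarized` (planner memo `Cruxes/MarkmanBiquadraticTwelvefolds/RETARGET-X1pol.md`), proved**:
for every `d > 0` and every abelian sixfold `(A, φ)` with `φ² = -d` carrying a non-zero `(3,3)` class in its Weil plane, there
is a non-square `m > 0` such that `(A ⊞ A, η_(d,m) = (φ ⊞ φ) ≫ (𝟙 + ψ_m))`, `ψ_m = biprod.lift (m • snd) fst`, is a POLARIZED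
hyperbolic Weil-type CM datum for `R_(d,m)(S) = S² + 2d(1+m)S + d²(m-1)²` (`IsPolarizedHyperbolicWeilTypeCM`: the polarization
class `E_A ⊕ m·E_A` has a KÄHLER real multiple, Rosati = complex conjugation on `L = ℚ(√-d, √m)`, split discriminant, rational
`η^*`-stable Lagrangian). The statement is X2 `BiquadraticBaseChangeHyperbolic` with its conclusion strengthened from
`IsHyperbolicWeilTypeCM` to `IsPolarizedHyperbolicWeilTypeCM`, polynomial and endomorphism spelled out as in the route file.
Proof = X2's proof (`biquadraticBaseChangeHyperbolic_proof`: `k = d κ + φ^*κ`, `m = 2` or `m = a·d·b` for `-q₀ = a/b`,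
`h₂ = π₀^*k + m π₁^*k` with its Kähler multiple `hK2`) ending in §3 and the polarized transport §2 along `biprodIsoTwelvefold`.
HC / H2 / X1 are NOT proved by this theorem. [cite: Deligne1982HodgeCycles, §4 (4.5), Cor. 4.2, Lemma 4.6, Thm. 4.8 (a)–(b), §5 (c) p. 39]
[cite: vanGeemen1994HodgeAV, §5 (5.2–5.4)] [cite: Landherr1936HermitianForms] -/
theorem biquadraticBaseChangePolarized :
    ∀ d : ℕ, 0 < d → ∀ (A : AbelianVariety ℂ) (φ : A ⟶ A), A.dim = 2 * 3 → φ ≫ φ = -(d • 𝟙 A) →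
      (∃ w : complexBetti A.X (2 * 3), w ∈ weilClassesOf A φ 3 d ∧ w ≠ 0 ∧ IsOfHodgeType (2 * 3) A.X (2 * 3) 3 3 w) →
      ∃ m : ℕ, 0 < m ∧ ¬ IsSquare m ∧
        IsPolarizedHyperbolicWeilTypeCM (A ⊞ A)
          (biprod.map φ φ ≫ (𝟙 (A ⊞ A) + biprod.lift (m • (biprod.snd : A ⊞ A ⟶ A)) biprod.fst))
          (X ^ 2 + C (2 * (d : ℤ) * (1 + (m : ℤ))) * X + C ((d : ℤ) ^ 2 * ((m : ℤ) - 1) ^ 2)) 2 3 := by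
  intro d hd A φ hA6 hφ hw
  classical
  -- ### the Weil-type datum `(A, φ)` over `K = ℚ(√-d)`
  have hWA : IsWeilTypeCM A φ (X + C (d : ℤ)) 1 3 := isWeilTypeCM_quadratic_of_weilClass hd hA6 hφ hw
  haveI hFK : Fact (Irreducible (realPolyQ (X + C (d : ℤ)))) := hWA.fact_irreducible_map_real
  have hirrK : Irreducible (cmPolyQ (X + C (d : ℤ))) := hWA.irreducible
  have hApos : 0 < A.dim := by rw [hA6]; norm_num
  have hAeq : A.dim = A.dim - 1 + 1 := by omega
  -- ### the two-embedding class `k = d κ + φ^* κ`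
  obtain ⟨e, a, ha, ha0, -⟩ := exists_segreEmbedding_powSucc (twelvefold A)
  set κ : complexBetti A.X 2 :=
    complexBetti.map (biproduct.ι (fun _ : Fin 2 => A) 0).hom.hom.hom 2 (complexBetti.map e.ι 2 a) +
      complexBetti.map (biproduct.ι (fun _ : Fin 2 => A) 1).hom.hom.hom 2 (complexBetti.map e.ι 2 a) with hκ
  set k : complexBetti A.X 2 := (d : ℂ) • κ + complexBetti.map φ.hom.hom.hom 2 κ with hkdef
  have hκK : ∃ t : ℝ, t ≠ 0 ∧ IsKaehlerClass A.dim A.X ((t : ℂ) • κ) :=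
    exists_isKaehlerClass_smul_restrictions A hApos e ha ha0
  have hKk : ∃ t : ℝ, t ≠ 0 ∧ IsKaehlerClass A.dim A.X ((t : ℂ) • k) := exists_isKaehlerClass_smul_ksymm φ hd hκK
  have hQκ : IsRationalClass κ :=
    (isRationalClass_complexBetti_map _ (isRationalClass_complexBetti_map _ ha)).add
      (isRationalClass_complexBetti_map _ (isRationalClass_complexBetti_map _ ha))
  have hQk : IsRationalClass k := by
    have h1 := hQκ.smul (d : ℚ)
    rw [Rat.cast_natCast] at h1
    exact h1.add (isRationalClass_complexBetti_map _ hQκ)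
  have hk : complexBetti.map φ.hom.hom.hom 2 k = (d : ℂ) • k := map_ksymm_eq_smul' hφ κ
  have hrosk : ∀ x y : complexBetti A.X 1,
      polarizationPairingOne A.X k (A.dim - 1) (pullbackOne A φ x) y =
        -polarizationPairingOne A.X k (A.dim - 1) x (pullbackOne A φ y) :=
    fun x y ↦ polarizationPairingOne_map_left_of_map_eq_smul hAeq hd hφ hk x y
  have hpolk : IsPolarizationClass A.dim A.X k := isPolarizationClass_of_isKaehlerClass_smul hQk hKk
  have hLk : lefschetzPow k (A.dim - 1) 2 k ≠ 0 :=
    Literature.AlgebraicGeometry.Motives.AbelianVariety.lefschetzPow_self_ne_zero_of_hasHardLefschetzProperty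
      (by omega) hpolk.hasHardLefschetz
  -- ### Deligne's discriminant of `(A, φ, k)` relative to `K`: a rational `q₀` with `(-1)³ q₀ > 0`
  obtain ⟨δ, x, ωA, c, Φ, q, hx, hli, hωArat, hωA0, hQx, htr, hdet, -⟩ := exists_hasWeilDiscriminantCM hWA hQk hKk hrosk
  have h1 : Module.finrank ℂ (complexBetti A.X (2 + 2 * (A.dim - 1))) = 1 :=
    Literature.AlgebraicGeometry.Motives.finrank_complexBetti_two_add_two_mul_eq_one
      (Literature.AlgebraicGeometry.Motives.isSmoothProjective_of_dim_eq' hAeq)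
  obtain ⟨tA, htA⟩ := Literature.AlgebraicGeometry.Motives.exists_eq_ratCast_smul_of_finrank_eq_one h1
    (HodgeRiemannDegreeOne.IsRationalClass.lefschetzPow hQk _ hQk) hLk hωArat
  have htA0 : tA ≠ 0 := by
    rintro rfl
    exact hωA0 (by rw [htA, Rat.cast_zero, zero_smul])
  obtain ⟨q₀, hq₀⟩ := exists_eq_algebraMap_realField_quadratic d (q : realField (X + C (d : ℤ)))
  rw [AdjoinRoot.algebraMap_eq] at hq₀
  have hq' : AdjoinRoot.of (cmPolyQ (X + C (d : ℤ))) q₀ = cmRoot (X + C (d : ℤ)) ^ (2 * 3) * Φ.det := by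
    rw [← hdet, hq₀, algebraMap_realField_eq, realToCM_of, AdjoinRoot.algebraMap_eq]
  have hq0 : q₀ ≠ 0 := fun h0 ↦ q.ne_zero (by rw [hq₀, h0, map_zero])
  haveI hFKc : Fact (Irreducible (cmPolyQ (X + C (d : ℤ)))) := ⟨hirrK⟩
  have hsign := neg_one_pow_mul_ratDisc_pos hd hWA hQk hrosk hKk hx hωArat hωA0 hQx htr hq0 hq'
  have hneg : 0 < -q₀ := by linarith [hsign, show (-1 : ℚ) ^ 3 * q₀ = -q₀ by ring]
  -- ### `-q₀ = a/b`; the choice of `m` and of `v ∈ F` with `d v² = -q₀`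
  set r : ℚ := -q₀ with hr
  have hab : ((r.num.natAbs : ℕ) : ℚ) / r.den = -q₀ := by
    have hnum : ((r.num.natAbs : ℕ) : ℤ) = r.num := Int.natAbs_of_nonneg (Rat.num_nonneg.2 hneg.le)
    have hnum' : ((r.num.natAbs : ℕ) : ℚ) = (r.num : ℚ) := by rw [← Int.cast_natCast (R := ℚ) r.num.natAbs, hnum]
    rw [hnum', Rat.num_div_den r]
  have hchoice : ∃ m : ℕ, ¬ IsSquare m ∧ ∃ v : realField (bqPoly d m),
      (d : realField (bqPoly d m)) * v ^ 2 = AdjoinRoot.of (realPolyQ (bqPoly d m)) (-q₀) := by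
    have h2sq : ¬ IsSquare (2 : ℕ) := by
      rintro ⟨r, hr⟩
      have h : r ≤ 2 := by nlinarith
      interval_cases r <;> omega
    by_cases hsq : IsSquare (r.num.natAbs * d * r.den)
    · have hW2 := isWeilTypeCM_twelvefold hWA h2sq
      obtain ⟨v, hv⟩ := exists_mul_sq_eq_of_isSquare d 2 hW2.irreducible_map_real hd r.den_pos hsq
      exact ⟨2, h2sq, v, by rw [hv, hab]⟩
    · have hWm := isWeilTypeCM_twelvefold hWA hsq
      obtain ⟨v, hv⟩ := exists_mul_sq_eq_of_eq d (r.num.natAbs * d * r.den) hWm.irreducible hWm.irreducible_map_real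
        hd r.den_pos rfl
      exact ⟨_, hsq, v, by rw [hv, hab]⟩
  obtain ⟨m, hm, v, hv⟩ := hchoice
  have hm0 : m ≠ 0 := ne_zero_of_not_isSquare hm
  have hm1 : m ≠ 1 := ne_one_of_not_isSquare hm
  have hm2 : 2 ≤ m := by omega
  refine ⟨m, Nat.pos_of_ne_zero hm0, hm, ?_⟩
  -- ### Kähler multiple of `h₂ = π₀^* k + m π₁^* k` on `B = ⨁_{Fin 2} A` (X2's `hK2`: the positivity this file records)
  have hK2 : ∃ s : ℝ, s ≠ 0 ∧ IsKaehlerClass (twelvefold A).dim (twelvefold A).X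
      ((s : ℂ) • sumPolarizationClass (fun _ : Fin 2 => A) ![k, (m : ℂ) • k]) := by
    rw [sumPolarizationClass_two_eq]
    exact exists_isKaehlerClass_smul_prodClass hApos φ hd hm2 e ha ha0
  -- ### POLARIZED hyperbolic Weil type of `⨁_{Fin 2} A` (§3), then of `A ⊞ A` (§2)
  have hq6 : AdjoinRoot.of (cmPolyQ (X + C (d : ℤ))) q₀ = cmRoot (X + C (d : ℤ)) ^ 6 * Φ.det := hq'
  have hB : IsPolarizedHyperbolicWeilTypeCM (twelvefold A) (etaTwo A φ m) (bqPoly d m) 2 3 :=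
    isPolarizedHyperbolicWeilTypeCM_twelvefold hd hm hφ hWA hirrK hQk hk hKk hK2 htA0 hq0 hx hli htA hQx htr hq6 hv
  exact isPolarizedHyperbolicWeilTypeCM_of_iso (biprodIsoTwelvefold A) (etaBiprod_comp_biprodIsoTwelvefold_hom A φ m) hB

end Summit.HodgeConjecture.HodgeConjecture.BiquadraticSecantLift

end
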